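/- Copyright: the b2b-balaban cell (near-miss cell 7), T⁴-continuum fan-out; row NE7b CRUX team (2).  Typed into the
tree by LEAF PROVER 02 (lineage `t4-ne7b-formalise-leaf-02`, gen 115) on the OWNER's INTERFACE REQUEST NE7b IR-102-3
(seat `t4-ne7b-p1` gen 102); the mathematics (§§1–6 below, every statement and every proof) is the NE7b CRUX REFUTER's
(pricing desk, gen 58: scratch `g58_joint_print_admissible.lean` sha16 19b214c20d90d985, finding F312 ∕ π-ne7bref-g58-1),
reached independently (other tuple, `q′ = 6`) by `pub-balaban-gaps-ne6` gen 5 (`JointWithPrintOrder` e10902a0963ebd01).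
(α)-JOINT AT THE CENSUS LETTERS, part 0′: a PRINT-ADMISSIBLE tuple at `d = 4`, `L = 13`, `M = 13`, `γ₀ = ½`, `A₁ = 48`.
Released under the licence of the surrounding project. -/
import Summits.QuantumFields.BalabanUV.T4Continuum.Support.HistoryRealiseCellsRunAssemblyWTVSJointLetters13
import Literature.MathematicalPhysics.QuantumFieldTheory.Balaban1983to89.B16LargeFieldFactors380

/-!
# (α)-JOINT AT THE CENSUS LETTERS, part 0′: ONE TUPLE AT `d = 4`, `L = 13`, `M = 13` THAT ALSO MEETS PRINT's
LETTER-LEVEL RELATIONS («p₁ < p₀», «2p₁ − (d+5)r₀ > p₀», «A₁ ≧ 48», `γ₀ = ½`), CLOSING THE TERMINAL's OUTSIDE BINDERS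
AND THE END-R RECORD's LETTER ROWS AT ONCE (sibling of `…JointLetters13`; refuter gen 58's census witness, typed by
leaf-02 gen 115 on IR-102-3)

Summits-side support leaf of the T⁴-continuum cell (rung (B)+1 on a FINITE torus only; NOT infinite volume, NOT the
mass gap, NOT Clay; NOT a proof of NE7b — the cell's OWN estimate, NOT PRINTED, NOT PROVED).  [decided arithmetic]
Two `def`s (`C₄₈`, `O₄₈`) and decided (in)equalities between numerals WE chose; nothing printed asserted, no
`def … : Prop` fact, no cite-tagged hypothesis, zero `sorry`.

WHY.  `…JointLetters13` (owner gen 54) showed the terminal theorem's seventeen outside letter binders and the record's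
letter rows jointly satisfiable at the census letters `(d, L, M) = (4, 13, 13)` with `C₁₃ ∕ O₄` (`p₀ = 8`,
`q′ = 6`, `A₁ = 1`, `γ₀ = 2`), census `(p₁, η, η′, κ, κ₂, κᵥ) = (8, 1, 2, 9, 1, 11)` for the `S_h`-road record
(`t = d+3`) and `p₁ = 9` for the END-R record's rows at `t = d+5` (owner gen 57 (R4)).  The NE7b refuter (gen 58, pricing
`pub-balaban-gaps-ne6` gen 5's located remark on `B16PrepFactorsLargest383` v1.2) observed that this tuple is NOT
print-admissible: `p₁ = 9 ≥ p₀ = 8` against [IV] p. 183 l. 1 «p₁ < p₀», and `A₁ = 1 < 48` against [B16] p. 382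
«A₁ ≧ 48» — and priced the question whether the END-R record's letter rows (1R `TowerReadDataLWR`, rounded,
`t = d+5`), the terminal's outside letter binders and `ThresholdOK` RE-CLOSE JOINTLY at a tuple that ALSO meets
print's letter-level relations {«p₁ < p₀», «2p₁ − (d+5)r₀ > p₀» (p. 383), «A₁ ≧ 48» (p. 382), «A₀, A₁ ≥ 1»
(GAPS G-B16-07 R2∕R4), `γ₀ = ½` (p. 380), `1 ≤ γ₀A₁²` (the (P)-supplier's side condition)}.  ANSWER (decided
arithmetic): YES — this file is that witness, put into the tree now (owner's GO, IR-102-3) rather than at (A1c) time.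

WHAT.  §1 `C₄₈ A₀ := ⟨13, 0, 10, 1, 1, 54, 2, 0, 1, 1∕2, A₀, 12⟩` (`q′ = 10`, `p₀ = 12`, EVERY `A₀ ≥ 1` — print's
R2∕R3 enlargements of `A₀` are free), `O₄₈ := ⟨4, 13, 1∕2, 48, 1∕7, 1, 1, 1, 1⟩` (`γ₀ = ½`, `A₁ = 48`).  §2
`print_rows_C₄₈` — print's letter-level rows hold at the tuple with census `p₁ = 11`, `rr = 1`;
`census_of_record_not_print_admissible` — `C₁₃ ∕ O₄` fails exactly «p₁ < p₀» and «A₁ ≧ 48».  §3 `valid_C₄₈`,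
`thresholdOK_C₄₈ : ThresholdOK (C₄₈ A₀) 13 1 (1∕13)`, `joint_outside_C₄₈` — the terminal's seventeen outside letter
binders verbatim as in `joint_outside_C₁₃` (only `hslack`'s right member changes, `γ₀A₁²∕2 = 576`).  §4
`joint_recordR_C₄₈` — the 27 letter rows of 1R's `TowerReadDataLWR` (`B16HistoryTowerEndDataLWR`, `t = d+5`) at
`(C₄₈, O₄₈)`, `d = 4`, `rr = 1`, census `(p₁, η, η′, κ, κ₂, κᵥ) = (11, 1, 2, 13, 5, 19)`, `m := 2304 = A₁²`; an
`example` records that the `S_h`-road record `TowerReadDataLWL` (`t = d+3`) closes at the same letters only with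
`p₁ = 10`.  §5 WHY the re-tune is the least one: `twelve_le_p₀` (under «p₁ < p₀» the rounded row forces
`p₀ ≥ rr(d+5) + η + 2 = 12`), `eta_lt_eta'` (`hexpR`, `hexpR′` and `ThresholdOK.rq_lt` force `η < η′`),
`family_closes` ∕ `family_closes₂` (one- and two-parameter families of closing tuples, the latter containing
gaps-ne6 gen 5's independent tuple `(p₀, q′) = (12, 6)`), `eta_pinned`.  §6 `m_window_C₄₈` — IR-101-2's one
inequality-shaped row `m ≤ minConst B₃ A₀ A₁` joins the tuple at `m := A₁² = 2304` for every `B₃ ≠ 0` and every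
`A₀` with `2B₃²A₁² ≤ A₀²` (print's own R2-consequence, met by ENLARGING `A₀`, which §§3–4 leave free), via
`B16LargeFieldFactors380.min_eq_A1sq`.

HONEST.  Decided arithmetic over OUR letters; print's rows enter only as (in)equalities between numerals we chose,
with the refuter's page locators quoted for the reader; every model constant of `C₄₈` and every O(1) of `O₄₈` stays a
symbol chosen by us (the census is a MODEL tuple; `irThresholdZ` untouched; TRIGGER c1 ∕ c2 ∕ c6 honoured).  Nothing
of Bałaban's is asserted, valued or discharged; every R-class row of the wall stays; (A1c) untouched; NE7b NOT
PRINTED ∕ NOT PROVED; spine 0∕9.  HONEST DEPENDENCY (cell): continuum YM on T⁴ ⇐ BetaPertH ∧ nine spine estimates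
(0/9 proved); BetaPertH ⇐ (D1) ∧ (D4) ∧ CAP+tail; G-an2-4 gates asym, D1 and NE2/3/4.  Unchanged here.
-/

open Literature.MathematicalPhysics.QuantumFieldTheory.Balaban1983to89
open Summit.QuantumFields.BalabanUV.T4Continuum.CountThresholdUniform (ThresholdOK)
open Summit.QuantumFields.BalabanUV.T4Continuum.HistoryZoneEvolve (cth)
open Summit.QuantumFields.BalabanUV.T4Continuum.HistoryConstants (PrintedO1s)
open Summit.QuantumFields.BalabanUV.T4Continuum.HistoryRealiseCellsRunAssemblyWTVSJointLetters
  (Cj birthMass_Cj_le_one birthMass_Cj_nonneg)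
open Summit.QuantumFields.BalabanUV.T4Continuum.HistoryRealiseCellsRunAssemblyWTVSJointLetters13
  (C₁₃ O₄ cth_32_1_34)

namespace Summit.QuantumFields.BalabanUV.T4Continuum.HistoryRealiseCellsRunAssemblyWTVSJointLetters48

noncomputable section

/-! ## §1 A print-admissible letter tuple -/

/-- `C₄₈ A₀ = ⟨n₁, dC, q′, E₂, E₃, κ₁, E₀, Eb, μ, a, A₀, p₀⟩ := ⟨13, 0, 10, 1, 1, 54, 2, 0, 1, 1∕2, A₀, 12⟩` (= `C₁₃` but
`q′ = 10`, `p₀ = 12`, and print's `A₀` LEFT FREE: every row below holds for ALL `A₀ ≥ 1`, so print's ratio relations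
GAPS G-B16-07 R2 `8B₃²(1+β₀)²A₁² ≤ A₀²` ∕ R3 `4·O(1)B₃M²A₁² ≤ A₀²` — which only ENLARGE `A₀` — cost nothing here).
[decided arithmetic] -/
def C₄₈ (A₀ : ℝ) : T4PrintedShapeBanking.Consts := ⟨13, 0, 10, 1, 1, 54, 2, 0, 1, 1 / 2, A₀, 12⟩

variable {A₀ : ℝ}

/-- `O₄₈ = ⟨d, M, γ₀, A₁, β₀, o80, o81, o87, o88⟩ := ⟨4, 13, 1∕2, 48, 1∕7, 1, 1, 1, 1⟩` (= `O₄` but print's `γ₀ = ½`,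
`A₁ = 48`). [decided arithmetic] -/
def O₄₈ : PrintedO1s := ⟨4, 13, 1 / 2, 48, 1 / 7, 1, 1, 1, 1⟩

/-- field read-back [decided arithmetic] -/ @[simp] theorem C₄₈_n₁ : (C₄₈ A₀).n₁ = 13 := rfl
/-- field read-back [decided arithmetic] -/ @[simp] theorem C₄₈_dC : (C₄₈ A₀).dC = 0 := rfl
/-- field read-back [decided arithmetic] -/ @[simp] theorem C₄₈_q' : (C₄₈ A₀).q' = 10 := rfl
/-- field read-back [decided arithmetic] -/ @[simp] theorem C₄₈_E₂ : (C₄₈ A₀).E₂ = 1 := rfl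
/-- field read-back [decided arithmetic] -/ @[simp] theorem C₄₈_E₃ : (C₄₈ A₀).E₃ = 1 := rfl
/-- field read-back [decided arithmetic] -/ @[simp] theorem C₄₈_κ₁ : (C₄₈ A₀).κ₁ = 54 := rfl
/-- field read-back [decided arithmetic] -/ @[simp] theorem C₄₈_E₀ : (C₄₈ A₀).E₀ = 2 := rfl
/-- field read-back [decided arithmetic] -/ @[simp] theorem C₄₈_Eb : (C₄₈ A₀).Eb = 0 := rfl
/-- field read-back [decided arithmetic] -/ @[simp] theorem C₄₈_μ : (C₄₈ A₀).μ = 1 := rfl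
/-- field read-back [decided arithmetic] -/ @[simp] theorem C₄₈_a : (C₄₈ A₀).a = 1 / 2 := rfl
/-- field read-back [decided arithmetic] -/ @[simp] theorem C₄₈_A₀ : (C₄₈ A₀).A₀ = A₀ := rfl
/-- field read-back [decided arithmetic] -/ @[simp] theorem C₄₈_p₀ : (C₄₈ A₀).p₀ = 12 := rfl
/-- field read-back [decided arithmetic] -/ @[simp] theorem O₄₈_d : O₄₈.d = 4 := rfl
/-- field read-back [decided arithmetic] -/ @[simp] theorem O₄₈_M : O₄₈.M = 13 := rfl
/-- field read-back [decided arithmetic] -/ @[simp] theorem O₄₈_γ₀ : O₄₈.γ₀ = 1 / 2 := rfl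
/-- field read-back [decided arithmetic] -/ @[simp] theorem O₄₈_A₁ : O₄₈.A₁ = 48 := rfl
/-- field read-back [decided arithmetic] -/ @[simp] theorem O₄₈_β₀ : O₄₈.β₀ = 1 / 7 := rfl

/-- `birthMass` reads only `Eb` and `μ`: `birthMass C₄₈ = birthMass Cj`. [decided arithmetic] -/
theorem birthMass_C₄₈ : T4CanonicalMenus.birthMass (C₄₈ A₀) = T4CanonicalMenus.birthMass Cj := rfl

/-! ## §2 PRINT's letter-level relations at the tuple (the rows `C₁₃ ∕ O₄` fail) -/

/-- print's rows at `(C₄₈, O₄₈)`, census `p₁ = 11`, `rr = 1`: [IV] p. 183 «p₁ < p₀»; [B16] p. 383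
«2p₁ − (d+5)r₀ > p₀»; p. 382 «A₁ ≧ 48»; R2∕R4 `A₀, A₁ ≥ 1`; p. 380 `γ₀ = ½`; the (P)-supplier's `1 ≤ γ₀A₁²`;
G-B16-07 R9 «p₀ > (d+2)r₀» — as (in)equalities between OUR numerals. [decided arithmetic] -/
theorem print_rows_C₄₈ (hA₀ : 1 ≤ A₀) :
    (11 : ℕ) < (C₄₈ A₀).p₀ ∧ (C₄₈ A₀).p₀ < 2 * 11 - (O₄₈.d + 5) * 1 ∧ (48 : ℝ) ≤ O₄₈.A₁ ∧ (1 : ℝ) ≤ (C₄₈ A₀).A₀ ∧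
      (1 : ℝ) ≤ O₄₈.A₁ ∧ O₄₈.γ₀ = 1 / 2 ∧ (1 : ℝ) ≤ O₄₈.γ₀ * O₄₈.A₁ ^ 2 ∧ (O₄₈.d + 2) * 1 < (C₄₈ A₀).p₀ := by
  refine ⟨by norm_num, by norm_num, by norm_num, by simpa using hA₀, by norm_num, rfl, by norm_num, by norm_num⟩

/-- the census of record is NOT print-admissible: at `C₁₃ ∕ O₄` with `p₁ = 9`, «p₁ < p₀» and «A₁ ≧ 48» both FAIL
(and these are the only two printed rows it fails: the p. 383 proviso `8 < 18 − 9` holds, owner gen 57 (R4)).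
[decided arithmetic] -/
theorem census_of_record_not_print_admissible :
    ¬ ((9 : ℕ) < C₁₃.p₀) ∧ ¬ ((48 : ℝ) ≤ O₄.A₁) ∧ C₁₃.p₀ < 2 * 9 - (O₄.d + 5) * 1 := by
  refine ⟨by decide, by norm_num [O₄], by decide⟩

/-! ## §3 The terminal's side: `ThresholdOK` and the seventeen outside letter binders at `(C₄₈, O₄₈)` -/

/-- `C₄₈ A₀` is valid (for every `A₀`). [decided arithmetic] -/
theorem valid_C₄₈ : (C₄₈ A₀).Valid where
  E₂_nonneg := by norm_num
  E₃_nonneg := by norm_num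
  κ₁_nonneg := by norm_num
  E₀_nonneg := by norm_num
  Eb_nonneg := le_rfl
  μ_nonneg := by norm_num
  dC_le := by simp [T4PersistenceDictionary.fatWait]

/-- **`ThresholdOK (C₄₈ A₀) 13 1 (1∕13)`** for every `A₀ ≥ 1` — `rq_lt : 1·(10+1) < 12`. [decided arithmetic] -/
theorem thresholdOK_C₄₈ (hA₀ : 1 ≤ A₀) : ThresholdOK (C₄₈ A₀) 13 1 (1 / 13) where
  valid := valid_C₄₈
  a_pos := by norm_num
  A₀_pos := by simp only [C₄₈_A₀]; linarith
  one_le_L := by norm_num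
  β₀_nonneg := by norm_num
  rq_lt := by norm_num

/-- **THE SEVENTEEN OUTSIDE LETTER BINDERS** (`hμ hκ₁ hE₀ hA₀ hβ₀ hLβ hn₁ hn hθ hslack hE₂ hE₃ hsS hsmall hθc0 hθc1
hθcs`), verbatim as in `joint_outside_C₁₃` with `(C, O) := (C₄₈ A₀, O₄₈)`, `A₀ ≥ 1`; only `hslack`'s right member
changes (`γ₀A₁²∕2 = 576`). [decided arithmetic] -/
theorem joint_outside_C₄₈ (hA₀ : 1 ≤ A₀) :
    0 < (C₄₈ A₀).μ ∧
    ((4 : ℕ) : ℝ) * Real.log ((13 : ℕ) : ℕ) + 2 * Real.log 2 ≤ (C₄₈ A₀).κ₁ ∧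
    Real.log (2 + T4CanonicalMenus.birthMass (C₄₈ A₀)) ≤ (C₄₈ A₀).E₀ ∧
    1 ≤ (C₄₈ A₀).A₀ ∧
    (0 : ℝ) < 1 / 13 ∧ ((13 : ℕ) : ℝ) * (1 / 13) ≤ 1 ∧
    13 ≤ (C₄₈ A₀).n₁ ∧ (0 : ℕ) < 1 ∧
    (0 : ℝ) < 1 / 8 ∧ (C₄₈ A₀).a + (1 / 8 + 1 / 8) ≤ O₄₈.γ₀ * O₄₈.A₁ ^ 2 / 2 ∧
    0 < (C₄₈ A₀).E₂ ∧ 0 ≤ (C₄₈ A₀).E₃ ∧ (1 : ℕ) ≤ 34 ∧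
    (((2 * cth 32 1 34 + 1) ^ 4 : ℕ) : ℝ) * (5 : ℝ) ^ 4 * ((max 1 (2 * 32 + 2) : ℕ) : ℝ) ≤
        ((13 : ℕ) : ℝ) ^ (34 / 2) / 2 ∧
    (0 : ℝ) ≤ 49 / 50 ∧ (49 / 50 : ℝ) < 1 ∧ (1 / 2 : ℝ) ≤ (49 / 50) ^ 34 := by
  refine ⟨by norm_num, ?_, ?_, by simpa using hA₀, by norm_num, by norm_num, by norm_num, one_pos, by norm_num, ?_,
    by norm_num, by norm_num, by norm_num, ?_, by norm_num, by norm_num, by norm_num⟩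
  · have h1 : Real.log (13 : ℝ) ≤ (13 : ℝ) - 1 := Real.log_le_sub_one_of_pos (by norm_num)
    have h2 : Real.log 2 < 1 := by
      have := Real.log_two_lt_d9; linarith
    have h13 : (((13 : ℕ) : ℕ) : ℝ) = (13 : ℝ) := by norm_num
    rw [h13]
    simp only [C₄₈_κ₁, Nat.cast_ofNat]
    linarith
  · have h1 : Real.log (2 + T4CanonicalMenus.birthMass (C₄₈ A₀)) ≤ 2 + T4CanonicalMenus.birthMass (C₄₈ A₀) - 1 :=
      Real.log_le_sub_one_of_pos (by rw [birthMass_C₄₈]; linarith [birthMass_Cj_nonneg])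
    rw [birthMass_C₄₈] at h1 ⊢
    simp only [C₄₈_E₀]
    linarith [birthMass_Cj_le_one]
  · norm_num [O₄₈]
  · rw [cth_32_1_34]; norm_num

/-! ## §4 The END-R record's letter rows (1R `TowerReadDataLWR`, rounded, `t = d+5`) at `(C₄₈, O₄₈)`, `d = 4`,
`rr = 1` -/

/-- **THE 27 LETTER ROWS OF `TowerReadDataLWR`** (`B16HistoryTowerEndDataLWR`, owner gen 101) at `(C₄₈ A₀, O₄₈)`,
`A₀ ≥ 1`, record dimension `d = 4`, `rr = 1`, census `(p₁, η, η′, κ, κ₂, κᵥ) := (11, 1, 2, 13, 5, 19)`, `m := 2304`,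
window letters `cΛ = M = Φ := 0`, `β₀ := 1∕13`, `θv := 1∕8`, `F.L = 13`, `p27 = 1` — in the record's order: `hcΛ hMΛ
hL4 hn₁ hE₂ hE₃pos hθv hβ₀ hΦ hm hexpR hexpR′ hexpB hexpFL hdq hexpVL hη hη′ hκ hκ₂ hκᵥ hp₀c hγ₀ hA₁ hA₀ hM hp27`.
[decided arithmetic] -/
theorem joint_recordR_C₄₈ (hA₀ : 1 ≤ A₀) :
    (0 : ℝ) ≤ 0 ∧ (0 : ℝ) ≤ 0 ∧ (4 : ℕ) ≤ 13 ∧ 13 ≤ (C₄₈ A₀).n₁ ∧ 0 < (C₄₈ A₀).E₂ ∧ 0 < (C₄₈ A₀).E₃ ∧ (0 : ℝ) < 1 / 8 ∧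
    (0 : ℝ) ≤ 1 / 13 ∧ (0 : ℝ) ≤ 0 ∧ O₄₈.A₁ ^ 2 ≤ (2304 : ℝ) ∧
    (C₄₈ A₀).p₀ + 1 * (O₄₈.d + 5) + 1 = 2 * 11 ∧ 1 * ((C₄₈ A₀).q' + 1) + 1 * (O₄₈.d + 5) + 2 = 2 * 11 ∧
    1 * ((C₄₈ A₀).q' + 1) + 13 = 2 * (C₄₈ A₀).p₀ ∧ 1 + 5 = 1 * ((C₄₈ A₀).q' - 4) ∧ 4 ≤ (C₄₈ A₀).q' ∧
    1 + 1 * 4 + 19 = 2 * (C₄₈ A₀).p₀ ∧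
    (1 : ℕ) ≤ 1 ∧ (1 : ℕ) ≤ 2 ∧ (1 : ℕ) ≤ 13 ∧ (1 : ℕ) ≤ 5 ∧ (1 : ℕ) ≤ 19 ∧ 1 ≤ (C₄₈ A₀).p₀ ∧
    0 < O₄₈.γ₀ ∧ O₄₈.A₁ ≠ 0 ∧ 0 < (C₄₈ A₀).A₀ ∧ 0 < O₄₈.M ∧ (1 : ℕ) ≤ 1 := by
  refine ⟨le_rfl, le_rfl, by norm_num, by norm_num, by norm_num, by norm_num, by norm_num, by norm_num, le_rfl,
    by norm_num [O₄₈], ?_, ?_, ?_, ?_, ?_, ?_, le_rfl, by norm_num, by norm_num, by norm_num, by norm_num, by norm_num,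
    by norm_num [O₄₈], by norm_num [O₄₈], by simp only [C₄₈_A₀]; linarith, by norm_num [O₄₈], le_rfl⟩ <;> norm_num

/-- THE SAME TUPLE ALSO CLOSES the `S_h`-road record `TowerReadDataLWL` (`t = d+3`; «DO NOT CONSUME», kept for the
record) only with a DIFFERENT `p₁`: at `t = d+3` the rows want `12 + 7 + η = 2p₁`, i.e. `p₁ = 10`, `η = 1`, `η′ = 2` —
and `p₁ = 10 < 12` too.  (Located, zero weight: ONE `p₁` cannot serve both records; the END road of record is LWR.)
[decided arithmetic] -/
example : (12 : ℕ) + 1 * (4 + 3) + 1 = 2 * 10 ∧ 1 * (10 + 1) + 1 * (4 + 3) + 2 = 2 * 10 ∧ (10 : ℕ) < 12 := by decide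

/-! ## §5 WHY `p₀ ≥ 12` and `η′ > η` are forced (the least print-admissible re-tune) -/

/-- under «p₁ < p₀» (`p₁ + 1 ≤ p₀`) the rounded row `p₀ + rr(d+5) + η = 2p₁` forces `rr(d+5) + η + 2 ≤ p₀`; at
`d = 4`, `rr, η ≥ 1`: `12 ≤ p₀`. [decided arithmetic] -/
theorem twelve_le_p₀ (p₀ p₁ rr η : ℕ) (hR : p₀ + rr * (4 + 5) + η = 2 * p₁) (hord : p₁ + 1 ≤ p₀) (hrr : 1 ≤ rr)
    (hη : 1 ≤ η) : 12 ≤ p₀ := by omega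

/-- … and `hexpR` with `hexpR′` ALONE give `p₀ + η = rr(q′+1) + η′`, so `ThresholdOK.rq_lt` (`rr(q′+1) < p₀`) forces
`η < η′` (`hexpB` is not even needed — located, zero weight). [decided arithmetic] -/
theorem eta_lt_eta' (p₀ p₁ q' rr t η η' : ℕ) (hR : p₀ + rr * t + η = 2 * p₁)
    (hR' : rr * (q' + 1) + rr * t + η' = 2 * p₁) (hrq : rr * (q' + 1) < p₀) : η < η' := by omega

/-- conversely nothing else binds: with `p₁ := p₀ − 1` the row `hexpR` pins `η = p₀ − 11` (so `p₀ = 12` is the least,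
and the ONLY value with `η = 1`), and for EVERY `p₀ = n + 12 ≥ 12` the tuple
`(p₁, q′, η, η′, κ, κ₂, κᵥ) := (n + 11, n + 10, n + 1, n + 2, n + 13, n + 5, 2n + 19)` closes all six identities
(`hexpR hexpR′ hexpB hexpFL hdq hexpVL`), the five gaps, `rq_lt`, «p₁ < p₀» and the p. 383 proviso at `rr = 1`,
`d = 4` (`n = 0` is §4's tuple). [decided arithmetic] -/
theorem family_closes (n : ℕ) :
    (n + 12) + 1 * (4 + 5) + (n + 1) = 2 * (n + 11) ∧ 1 * ((n + 10) + 1) + 1 * (4 + 5) + (n + 2) = 2 * (n + 11) ∧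
      1 * ((n + 10) + 1) + (n + 13) = 2 * (n + 12) ∧ 1 + (n + 5) = 1 * ((n + 10) - 4) ∧ 4 ≤ n + 10 ∧
      1 + 1 * 4 + (2 * n + 19) = 2 * (n + 12) ∧ 1 ≤ n + 1 ∧ 1 ≤ n + 2 ∧ 1 ≤ n + 13 ∧ 1 ≤ n + 5 ∧ 1 ≤ 2 * n + 19 ∧
      1 * ((n + 10) + 1) < n + 12 ∧ n + 11 < n + 12 ∧ n + 12 < 2 * (n + 11) - (4 + 5) * 1 := by
  omega

/-- TWO-PARAMETER FAMILY (covers this file's tuple `(p₀, q′) = (12, 10)` at `(n, j) = (0, 4)` AND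
`pub-balaban-gaps-ne6` gen 5's independent tuple `(p₀, q′) = (12, 6)`, census `(11, 1, 6, 17, 1, 19)`, at
`(n, j) = (0, 0)`): for every `p₀ = n + 12` and every `q′ = j + 6` with `j ≤ n + 4` (i.e. `6 ≤ q′ ≤ p₀ − 2`), the
census `(p₁, η, η′, κ, κ₂, κᵥ) := (p₀ − 1, p₀ − 11, 2p₀ − q′ − 12, 2p₀ − q′ − 1, q′ − 5, 2p₀ − 5)` closes the six
identities, the five gaps, `rq_lt`, «p₁ < p₀» and the p. 383 proviso (`rr = 1`, `d = 4`).  `q′ = 5` is excluded by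
`hexpFL`'s gap `κ₂ ≥ 1`, `q′ ≥ p₀ − 1` by `rq_lt`. [decided arithmetic] -/
theorem family_closes₂ (n j : ℕ) (hj : j ≤ n + 4) :
    (n + 12) + 1 * (4 + 5) + (n + 1) = 2 * (n + 11) ∧
      1 * ((j + 6) + 1) + 1 * (4 + 5) + (2 * n + 6 - j) = 2 * (n + 11) ∧
      1 * ((j + 6) + 1) + (2 * n + 17 - j) = 2 * (n + 12) ∧ 1 + (j + 1) = 1 * ((j + 6) - 4) ∧ 4 ≤ j + 6 ∧
      1 + 1 * 4 + (2 * n + 19) = 2 * (n + 12) ∧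
      1 ≤ n + 1 ∧ 1 ≤ 2 * n + 6 - j ∧ 1 ≤ 2 * n + 17 - j ∧ 1 ≤ j + 1 ∧ 1 ≤ 2 * n + 19 ∧
      1 * ((j + 6) + 1) < n + 12 ∧ n + 11 < n + 12 ∧ n + 12 < 2 * (n + 11) - (4 + 5) * 1 := by
  omega

/-- `pub-balaban-gaps-ne6` gen 5's tuple re-derived as bare numerals (`(p₀, q′) = (12, 6)`, census
`(11, 1, 6, 17, 1, 19)`): CONCUR. [decided arithmetic] -/
example : (12 : ℕ) + 1 * (4 + 5) + 1 = 2 * 11 ∧ 1 * (6 + 1) + 1 * (4 + 5) + 6 = 2 * 11 ∧ 1 * (6 + 1) + 17 = 2 * 12 ∧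
    1 + 1 = 1 * (6 - 4) ∧ (4 : ℕ) ≤ 6 ∧ 1 + 1 * 4 + 19 = 2 * 12 ∧ 1 * (6 + 1) < (12 : ℕ) ∧ (11 : ℕ) < 12 := by decide

/-- … and the pin itself: `p₁ = p₀ − 1`, `rr = 1`, `d = 4` in `hexpR` give `η = p₀ − 11` (so, with the gap `1 ≤ η`,
`12 ≤ p₀`, and `η = 1 ⇔ p₀ = 12`). [decided arithmetic] -/
theorem eta_pinned (p₀ η : ℕ) (hR : p₀ + 1 * (4 + 5) + η = 2 * (p₀ - 1)) (hη : 1 ≤ η) :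
    η = p₀ - 11 ∧ 12 ≤ p₀ ∧ (η = 1 ↔ p₀ = 12) := by omega

/-! ## §6 IR-101-2's ONE inequality-shaped table row joins the tuple

The owner's INTERFACE REQUEST NE7b IR-101-2 (`toTowerR := 3R's hw_of_stepDisplays_rounded + part 3 §4 hsB_of_tables`)
asks, in `hsB_of_tables`, the equalities `c.γ₀ = O.γ₀`, `c.A₀ = C.A₀`, `c.p₀ = C.p₀`, the sign `0 ≤ O.γ₀` and ONE
inequality `m ≤ minConst c.B₃ c.A₀ c.A₁`; with 1R's `hm : O.A₁² ≤ m` the window for `m` is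
`[A₁², min{½B₃⁻²A₀², 2A₁², A₁²}]`, non-empty iff print's R2-consequence `2B₃²A₁² ≤ A₀²`
(`B16LargeFieldFactors380.min_eq_A1sq`) — print's OWN constants relation (GAPS G-B16-07 R2), met by ENLARGING `A₀`,
which §§3–4 leave free.  So: NOT an `hsRdom`-class record-vs-print inequality; `m := A₁² = 2304` closes it at every
`A₀ ≥ √2·B₃·48`. -/

/-- the `m`-window of IR-101-2 at the tuple: `A₁² ≤ 2304 ≤ minConst B₃ A₀′ A₁` for every `B₃ ≠ 0` and every `A₀′` with
`2B₃²A₁² ≤ A₀′²`. [decided arithmetic] -/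
theorem m_window_C₄₈ (B₃ A₀' : ℝ) (hB₃ : B₃ ≠ 0) (hR2 : 2 * B₃ ^ 2 * O₄₈.A₁ ^ 2 ≤ A₀' ^ 2) :
    O₄₈.A₁ ^ 2 ≤ (2304 : ℝ) ∧ (2304 : ℝ) ≤ B16LargeFieldFactors380.minConst B₃ A₀' O₄₈.A₁ := by
  refine ⟨by norm_num [O₄₈], ?_⟩
  rw [B16LargeFieldFactors380.min_eq_A1sq hB₃ hR2]
  norm_num [O₄₈]

/-- numeric instance: `B₃ = 1`, `A₀ = 68`, `A₁ = 48`: `2·48² = 4608 ≤ 4624 = 68²` (and `A₀ = 10⁴`,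
`pub-balaban-gaps-ne6` gen 5's choice, a fortiori). [decided arithmetic] -/
example : 2 * (1 : ℝ) ^ 2 * (48 : ℝ) ^ 2 ≤ (68 : ℝ) ^ 2 ∧ 2 * (1 : ℝ) ^ 2 * (48 : ℝ) ^ 2 ≤ ((10 : ℝ) ^ 4) ^ 2 := by
  norm_num

end

end Summit.QuantumFields.BalabanUV.T4Continuum.HistoryRealiseCellsRunAssemblyWTVSJointLetters48
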